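import Summits.ABC.IUTFork.Joshi.TestGenuinePinsVacuityQuadratic
import Literature.IUT.LogVolume.GenuineSupportPrimesBound
import HarnessLib

/-!
# Branch E TEST — the DIVIDING LINE of the genuine-carrier pins (R-J row Y-26): the fixed-ball shape list is EXHAUSTIVE,
# and the Hermite–Minkowski cut «every `F ≠ ℚ` unramified at `2` and `3` has EMPTY pins»

Proof-only sequel (abc-iut cell, D-0079 R-J «Joshi Y-discharge census», row Y-26; seat abc-iut-E-t41, gen 4; 0 definitions, no `Prop`
fact, FACT rows used: none; rider (B) of abc-iut-E-plan's ruling 2026-08-27T02:41:05Z, KEEP = (B1) + (B2) + (B3)) to abc-iut-E-t44's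
`Joshi/TestGenuinePinsVacuity{,Tame,Ramified}.lean` (p445249 / p446217 / p446474), abc-iut-E-t43's `Joshi/TestGenuinePinsVacuity{Residual,
Quadratic}.lean` (p461298 / p461750) and this seat's positive half `Joshi/TestGenuinePinsInhabitedDegreeOne{,Rat}.lean` (p463284 / p463655).
Row of record: the three region pins of [IUTchIII] Cor. 3.12 on the Dupuy–Hilado carriers (abc-iut-c312-7's `settingPrVolSharp` over
`LatticeSituation.ofShells (logShellsDH X (analyticLogv F)) …`) are KERNEL-UNINHABITED as soon as ONE element of Dupuy–Hilado's (Ind2) group at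
ONE finite place `v` moves the unit ball `𝒪_v` (p446217), and INHABITED at `F = ℚ` (p463284).  THIS FILE (all movers / criteria / census
entries consumed BY NAME; the statements are abc-iut-E-cx-2's P2 asks of 2026-08-26T19:30:04Z / 19:49:15Z):

* (B1) `forall_ismDH_image_closedBall_one_eq_of_pinnedRegions_settingPrVolSharp` — `PinnedRegions` at `settingPrVolSharp` (analytic
  logarithms, any `X`, `ρ`, `qK`, column data, `Ψ`, ideles, column) ⇒ at EVERY finite place EVERY (Ind2)-element maps `𝒪_v` onto itself
  (contrapositive of p461750's `…_of_mover_at`); `exists_closedBall_one_eq_zpow_smul_logUnits_of_pinnedRegions_settingPrVolSharp` — hence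
  `𝒪_v = p^k·log_p(𝒪_v^×)` (abc-iut-w5-d180's BALL-MOVER CRITERION): p461298's residual-class criterion as a theorem;
* (B2) `GenuinePinsDividingLine.localShape_of_forall_ismDH_image_closedBall_one_eq` / `localShape_of_pinnedRegions_settingPrVolSharp` —
  THE FIXED-BALL SHAPE LIST IS EXHAUSTIVE: a fixed unit ball at `v ∣ p` forces `e(v|p) = 1` (and `f(v|p) = 1` if `p = 2`), OR `p = 3`,
  `(e, f) = (2, 1)`, `#μ_{3^∞}(F_v) = 3` (`ℚ_3(ζ_3)`-shape), OR `p = 2`, `(e, f) = (2, 1)`, `#μ_{2^∞}(F_v) = 2`, `log_2(𝒪_v^×) = 2𝒪_v`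
  (`ℚ_2(√3)`-shape) — abc-iut-w5-d039's census (`prime_le_three_…`, `eq_…_three`, `mem_…_two`), abc-iut-c312-5's complete dyadic column,
  and in the `(2, 1)` dyadic cell abc-iut-w4-d017's INTRINSIC trichotomy on `‖log_2(1 − ϖ)‖` (`UnitLogWildQuadraticDyadicCases`) with the
  PARITY LEMMA `forall_ismDH_image_closedBall_eq_iff_dvd_sub_of_logUnits_eq` (`log = 𝔪³` ⇒ `2 ∤ 0 − 3` ⇒ moved; `‖λ‖ = ‖ϖ‖` ⇒ no ball is a
  `2^k·log`) — `GenuinePinsDividingLine.logUnits_eq_closedBall_norm_two_of_forall_ismDH_image_closedBall_one_eq`;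
* (B3) HERMITE–MINKOWSKI CUT `exists_ramified_place_of_pinnedRegions_settingPrVolSharp`: `PinnedRegions` and `1 < [F : ℚ]` ⇒ `F` HAS a
  ramified place (Mathlib `NumberField.abs_discr_gt_two` + the tree's `Cor22.exists_ramified_place_of_dvd_discr`), which by (B2) is
  `ℚ_3(ζ_3)`- or `ℚ_2(√3)`-shaped; contrapositives `not_pinnedRegions(3)_settingPrVolSharp_of_not_dvd_discr` (`2 ∤ d_F`, `3 ∤ d_F`) and
  `…_of_unramified_two_three` (`e = 1` at every place over `2` and over `3`): **every number field `F ≠ ℚ` in which `2` and `3` are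
  unramified has KERNEL-EMPTY pins at the genuine carrier** — a class disjoint from «`F` has a quadratic subfield» (p488653).

CONSEQUENCE FOR THE RECORD (tree currency, no side taken): the kernel residual class of row Y-26 is cut to «`F = ℚ` (INHABITED) or `F ≠ ℚ`
RAMIFIED with every ramified place `ℚ_3(ζ_3)`- or `ℚ_2(√3)`-shaped, every other place on the fixed list, no quadratic subfield»; that this
located family is empty (root discriminant `≤ 2√3`: Hunter 1957 / Pohst 1982 / Diaz y Diaz 1984 / Odlyzko, abc-iut-E-cx-2 19:49:15Z) is a
PAPER statement NOT claimed here.  HONEST SCOPE: OUR interface, OUR sharp real container, Dupuy–Hilado's reading of (Ind2); nothing here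
bears on print's (xi-e)/(xi-f); locates / conditionally verifies; no abc claim. [claim: Mochizuki2012, status: disputed]
[cite: DupuyHilado2025, §4.9] [cite: WeilBNT1967, Ch. II §2, Th. 1–2] [cite: NeukirchANT1999, Ch. II Prop. (5.5), (5.7), Ch. III Thm. (2.12), (2.17)]
-/

noncomputable section

open Set Function NumberField IsDedekindDomain Metric
open scoped Pointwise

namespace Summit.ABC.IUTFork.Joshi

open Thm311 Thm311.Real Cor312 Cor312Vol Literature.IUT.LogThetaLattice Literature.IUT.LogVolume
  Literature.IUT.HodgeTheaters Literature.NumberTheory.NumberFields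
open Literature.NumberTheory.GaloisRepresentations.Ultrametric
open GenuinePinsResidual

namespace GenuinePinsDividingLine

/-! ## 1. Local: inside the `(2, 1)` dyadic cell a fixed unit ball forces `log_2(𝒪_v^×) = 2𝒪_v` -/

section DyadicLocal

variable {F : Type} [Field F] [NumberField F] {logv : PadicLogs F} (hlog : LogvAnalyticAt 2 logv)
  (v : HeightOneSpectrum (𝓞 F)) (hv : ((2 : ℕ) : 𝓞 F) ∈ v.asIdeal)

include hlog in
/-- **The `(2, 1)` dyadic cell: if EVERY (Ind2)-element fixes the unit ball of `F_v` (`v ∣ 2`, `e(v|2) = 2`, `f(v|2) = 1`), then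
`log_2(𝒪_v^×) = {‖y‖ ≤ ‖2‖} = 2𝒪_v = 𝔪_v²`** — the `ℚ_2(√3)`-shape.  abc-iut-w5-d180's criterion gives `𝒪_v = 2^k·log_2(𝒪_v^×)`;
abc-iut-w4-d017's intrinsic trichotomy on `λ = log_2(1 − ϖ)` leaves: `‖λ‖ = ‖ϖ‖` — no ball is a `2^k·log` (`closedBall_ne_zpow_smul_logUnits`);
`‖λ‖ ≤ ‖ϖ‖³` — `log = 𝔪³` and the parity lemma (`2 ∤ 0 − 3`) moves the unit ball; `‖λ‖ = ‖ϖ‖²` — `log = 𝔪² = 2𝒪_v`.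
[cite: DupuyHilado2025, §4.9] [cite: WeilBNT1967, Ch. II §2, Th. 2] [cite: NeukirchANT1999, Ch. II Prop. (5.5)] -/
theorem logUnits_eq_closedBall_norm_two_of_forall_ismDH_image_closedBall_one_eq (he : v.asIdeal.ramificationIdx ℤ = 2)
    (hf : v.asIdeal.inertiaDeg ℤ = 1)
    (h : ∀ g ∈ ismDH logv (.inr v),
      (fun a => toR 2 v hv (g (ofR 2 v hv a))) '' closedBall (0 : RescaledCompletion F 2 v hv) 1 = closedBall 0 1) :
    logUnits (RescaledCompletion F 2 v hv) = closedBall (0 : RescaledCompletion F 2 v hv) ‖(2 : RescaledCompletion F 2 v hv)‖ := by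
  set K := RescaledCompletion F 2 v hv
  have heK : absRamificationIdx 2 K = 2 := by rw [absRamificationIdx_rescaledCompletion F 2 v hv, he]
  have hfK : residueDegree 2 K = 1 := by rw [residueDegree_rescaledCompletion F 2 v hv, hf]
  obtain ⟨ϖ, hϖ, -⟩ := exists_isUniformizer_rescaledCompletion F 2 v hv
  -- abc-iut-w5-d180's criterion: the unit ball is a `2^k·log_2(𝒪_v^×)`
  have h1 : (1 : K) ≠ 0 := one_ne_zero
  obtain ⟨k, hk⟩ := (forall_ismDH_image_closedBall_eq_iff hlog v hv h1).1 (by rw [norm_one]; exact h)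
  -- `u₀ = 1 − ϖ ∈ U_1 ∖ U_2`, `λ = log_2 u₀`, `‖λ‖ ≤ ‖ϖ‖`
  set u₀ : K := 1 - (ϖ : K) with hu₀def
  have hu₀ : ‖1 - u₀‖ = ‖(ϖ : K)‖ := by rw [hu₀def, sub_sub_cancel]
  have hle : ‖unitLog u₀‖ ≤ ‖(ϖ : K)‖ := WildQuadraticDyadic.norm_unitLog_le_unif hϖ heK hfK u₀
  rcases hle.lt_or_eq with hlt | heq
  · rcases (WildQuadraticDyadic.norm_le_sq_of_norm_lt_unif hϖ hlt).lt_or_eq with hlt2 | heq2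
    · -- `‖λ‖ ≤ ‖ϖ‖³`: `log = 𝔪³`, and the parity lemma moves the unit ball (`e = 2 ∤ 0 − 3`)
      exfalso
      have hΛ := WildQuadraticDyadic.logUnits_eq_closedBall_of_norm_unitLog_le hϖ heK hfK hu₀
        (WildQuadraticDyadic.norm_le_cube_of_norm_lt_sq hϖ hlt2)
      have hΛ' : logUnits K = closedBall (0 : K) ‖(ϖ : K) ^ (3 : ℤ)‖ := by
        rw [hΛ, norm_zpow]; norm_cast
      have hfix : ∀ g ∈ ismDH logv (.inr v),
          (fun a => toR 2 v hv (g (ofR 2 v hv a))) '' closedBall (0 : K) ‖(ϖ : K) ^ (0 : ℤ)‖ =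
            closedBall 0 ‖(ϖ : K) ^ (0 : ℤ)‖ := by
        intro g hg
        rw [zpow_zero, norm_one]
        exact h g hg
      have hdvd := (forall_ismDH_image_closedBall_eq_iff_dvd_sub_of_logUnits_eq hlog v hv hϖ hΛ' 0).1 hfix
      rw [he] at hdvd
      omega
    · -- `‖λ‖ = ‖ϖ‖²`: `log = 𝔪² = 2𝒪_v`
      rw [WildQuadraticDyadic.logUnits_eq_closedBall_of_norm_unitLog_eq_sq hϖ heK hfK hu₀ heq2,
        WildQuadraticDyadic.norm_unif_sq_eq_norm_two hϖ heK]
  · -- `‖λ‖ = ‖ϖ‖`: no ball is a `2^k·log_2(𝒪_v^×)`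
    exfalso
    have hk' : closedBall (0 : K) ‖(1 : K)‖ = ((2 : ℚ_[2]) ^ k) • logUnits K := by
      simpa only [Nat.cast_ofNat] using hk
    exact WildQuadraticDyadic.closedBall_ne_zpow_smul_logUnits hϖ heK hfK hu₀ heq 1 k hk'

end DyadicLocal

/-! ## 2. Local: the fixed-ball shape list is exhaustive -/

section Local

variable {F : Type} [Field F] [NumberField F] {p : ℕ} [hp : Fact p.Prime] {logv : PadicLogs F} (hlog : LogvAnalyticAt p logv)
  (v : HeightOneSpectrum (𝓞 F)) (hv : ((p : ℕ) : 𝓞 F) ∈ v.asIdeal)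

include hlog in
/-- **THE FIXED-BALL SHAPE LIST IS EXHAUSTIVE.** At a finite place `v ∣ p` with `logv` analytic at `p`: if EVERY element of
Dupuy–Hilado's (Ind2) group fixes the unit ball `𝒪_v`, then `F_v` is of one of the shapes — `e(v|p) = 1` (and `f(v|p) = 1` when
`p = 2`: unramified over an odd prime, or `ℚ_2`); `p = 3`, `(e, f) = (2, 1)`, `#μ_{3^∞}(F_v) = 3` (`ℚ_3(ζ_3)`); `p = 2`, `(e, f) = (2, 1)`,
`#μ_{2^∞}(F_v) = 2`, `log_2(𝒪_v^×) = 2𝒪_v` (`ℚ_2(√3)`).  abc-iut-w5-d039's census + abc-iut-c312-5's complete dyadic column + §1.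
[cite: DupuyHilado2025, §4.9] [cite: WeilBNT1967, Ch. II §2, Th. 1–2] [cite: NeukirchANT1999, Ch. II Prop. (5.5), (5.7)] -/
theorem localShape_of_forall_ismDH_image_closedBall_one_eq
    (h : ∀ g ∈ ismDH logv (.inr v),
      (fun a => toR p v hv (g (ofR p v hv a))) '' closedBall (0 : RescaledCompletion F p v hv) 1 = closedBall 0 1) :
    (v.asIdeal.ramificationIdx ℤ = 1 ∧ (p = 2 → v.asIdeal.inertiaDeg ℤ = 1)) ∨
    (p = 3 ∧ v.asIdeal.ramificationIdx ℤ = 2 ∧ v.asIdeal.inertiaDeg ℤ = 1 ∧ torsionPExp p (RescaledCompletion F p v hv) = 1) ∨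
    (p = 2 ∧ v.asIdeal.ramificationIdx ℤ = 2 ∧ v.asIdeal.inertiaDeg ℤ = 1 ∧ torsionPExp p (RescaledCompletion F p v hv) = 1 ∧
      logUnits (RescaledCompletion F p v hv) =
        closedBall (0 : RescaledCompletion F p v hv) ‖(2 : RescaledCompletion F p v hv)‖) := by
  have he1 : 1 ≤ v.asIdeal.ramificationIdx ℤ := by
    rw [← absRamificationIdx_rescaledCompletion F p v hv]; exact absRamificationIdx_pos p (RescaledCompletion F p v hv)
  by_cases he : v.asIdeal.ramificationIdx ℤ = 1
  · refine Or.inl ⟨he, fun hp2 => ?_⟩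
    rcases mem_of_forall_ismDH_image_closedBall_one_eq_two hlog v hv hp2 h with
      ⟨-, h2, -⟩ | ⟨h1, -, -⟩ | ⟨h1, -, -⟩ | ⟨h1, -, -⟩
    · exact h2
    all_goals omega
  · have he2 : 2 ≤ v.asIdeal.ramificationIdx ℤ := by omega
    have hp3 : p ≤ 3 := prime_le_three_of_forall_ismDH_image_closedBall_one_eq hlog v hv he2 h
    have hp2' : 2 ≤ p := hp.out.two_le
    by_cases hp2 : p = 2
    · refine Or.inr (Or.inr ?_)
      rcases mem_of_forall_ismDH_image_closedBall_one_eq_two hlog v hv hp2 h with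
        ⟨h1, -, -⟩ | ⟨h1, h2, h3⟩ | ⟨h1, h2, -⟩ | ⟨h1, h2, -⟩
      · omega
      · subst hp2
        exact ⟨rfl, h1, h2, h3,
          logUnits_eq_closedBall_norm_two_of_forall_ismDH_image_closedBall_one_eq hlog v hv h1 h2 h⟩
      · exfalso
        subst hp2
        obtain ⟨g, hg, hne⟩ := exists_mem_ismDH_image_closedBall_one_ne_of_dyadic_complete hlog v hv he2 (by omega)
        exact hne (h g hg)
      · exfalso
        subst hp2
        obtain ⟨g, hg, hne⟩ := exists_mem_ismDH_image_closedBall_one_ne_of_dyadic_complete hlog v hv he2 (by omega)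
        exact hne (h g hg)
    · have hp3' : p = 3 := by omega
      exact Or.inr (Or.inl ⟨hp3', eq_of_forall_ismDH_image_closedBall_one_eq_three hlog v hv hp3' he2 h⟩)

end Local

end GenuinePinsDividingLine

open GenuinePinsDividingLine

/-! ## 3. At `settingPrVolSharp`: positive information from the pins -/

variable {F : Type} [Field F] [NumberField F] (X : PilotData F)
  (M : Type) [Field M] [NumberField M]
  (archPk : ∀ (j : (thetaIndex X).Label) (vQ : (thetaIndex X).VQ), Set ((logShellsDH X (analyticLogv F)).Packet j vQ))
  (archSub : ∀ (j : (thetaIndex X).Label) (v : (thetaIndex X).V),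
    Set ((logShellsDH X (analyticLogv F)).Packet j ((thetaIndex X).over v)))
  (Ψ : ℤ → ∀ v : (thetaIndex X).V, v ∈ (thetaIndex X).Vbad → Set ((logShellsDH X (analyticLogv F)).StarPacket v))
  (act : ℤ → ∀ v : (thetaIndex X).V, v ∈ (thetaIndex X).Vbad →
    (logShellsDH X (analyticLogv F)).StarPacket v → Module.End ℚ ((logShellsDH X (analyticLogv F)).StarPacket v))
  (Mmod : ℤ → ∀ j : (thetaIndex X).LabelStar, Set ((logShellsDH X (analyticLogv F)).GlobalPacket j.1))
  (region : ℤ → ∀ j : (thetaIndex X).LabelStar, FinDivisor M → ∀ vQ : (thetaIndex X).VQ,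
    Set ((logShellsDH X (analyticLogv F)).Packet j.1 vQ))
  (frobAdm : ℤ → ℤ → ∀ (j : (thetaIndex X).Label) (vQ : (thetaIndex X).VQ),
    Set ((logShellsDH X (analyticLogv F)).Packet j vQ) → Prop)
  (frobLogvol : ℤ → ℤ → ∀ (j : (thetaIndex X).Label) (vQ : (thetaIndex X).VQ),
    Set ((logShellsDH X (analyticLogv F)).Packet j vQ) → ℝ)
  (frobΨ : ℤ → ℤ → ∀ v : (thetaIndex X).V, v ∈ (thetaIndex X).Vbad → Set ((logShellsDH X (analyticLogv F)).StarPacket v))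
  (frobMmod : ℤ → ℤ → ∀ j : (thetaIndex X).LabelStar, Set ((logShellsDH X (analyticLogv F)).GlobalPacket j.1))
  (unitImage : ℤ → ℤ → ℕ → ∀ (j : (thetaIndex X).Label) (vQ : (thetaIndex X).VQ),
    Set ((logShellsDH X (analyticLogv F)).Packet j vQ))
  (ballImage : ℤ → ℤ → ∀ (j : (thetaIndex X).Label) (vQ : (thetaIndex X).VQ),
    Set ((logShellsDH X (analyticLogv F)).Packet j vQ))
  (thetaDiv : ℤ → ℤ → LgpDivisor M (thetaIndex X).lstar)
  (n : ℤ) {HT : Type} {LogLink : HT → HT → Type} {IsFull : ∀ {s t : HT}, LogLink s t → Prop}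
  (lat : LGPGaussianLogThetaLattice LogLink IsFull)
  {Frd : Type} {IsoF : Frd → Frd → Type} {Ob : Frd → Type} {realify : Frd → Frd} {Strip : Type}
  {IsoS : Strip → Strip → Type} {Mv : ∀ v : (thetaIndex X).V, v ∈ (thetaIndex X).Vbad → Type}
  [∀ v h, Monoid (Mv v h)]
  (sig : GlobalLGPFrobenioidSignature (thetaIndex X).lstar (thetaIndex X).V (· ∈ (thetaIndex X).Vbad)
    Frd IsoF Ob realify Strip IsoS Mv)
  (split : SplittingMonoids Mv) {ObΔ : Type} {N : ∀ v : (thetaIndex X).V, v ∈ (thetaIndex X).Vbad → Type}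
  [∀ v h, Monoid (N v h)] (qData : QPilotData ObΔ N)
  (t : ∀ (pp : Nat.Primes) (_ : Fin X.lstar) (x : (thetaIndex X).Fibre (.inr pp)),
    haveI : Fact (pp : ℕ).Prime := ⟨pp.2⟩; kOf X pp.1 x)
  (tq : ∀ (pp : Nat.Primes) (x : (thetaIndex X).Fibre (.inr pp)), haveI : Fact (pp : ℕ).Prime := ⟨pp.2⟩; kOf X pp.1 x)
  (ρ : (∀ v : (thetaIndex X).V, v ∈ (thetaIndex X).Vbad → Set ((logShellsDH X (analyticLogv F)).StarPacket v)) →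
    ∀ (j : (thetaIndex X).Label) (vQ : (thetaIndex X).VQ), Set ((logShellsDH X (analyticLogv F)).Packet j vQ))
  (qK : ∀ v : (thetaIndex X).V, v ∈ (thetaIndex X).Vbad → Set ((logShellsDH X (analyticLogv F)).StarPacket v))
  (htq0 : ∀ pp x, tq pp x ≠ 0)
  (htq1 : ∀ (pp : Nat.Primes) (x : (thetaIndex X).Fibre (.inr pp)),
    haveI : Fact (pp : ℕ).Prime := ⟨pp.2⟩; placeOf X pp.1 x ∉ X.S → ‖tq pp x‖ = 1)

/-- **(B1) POSITIVE INFORMATION FROM THE PINS: if `PinnedRegions` holds at `settingPrVolSharp`** (analytic logarithms; any `X`, `ρ`,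
`qK`, column data, `Ψ`, ideles, column) **then at EVERY finite place `v₀ ∣ q` EVERY element of Dupuy–Hilado's (Ind2) group maps `𝒪_{v₀}`
onto itself** — contrapositive of p461750's `…_of_mover_at` (p446217's criterion). [cite: DupuyHilado2025, §4.9] [claim: Mochizuki2012, status: disputed] -/
theorem forall_ismDH_image_closedBall_one_eq_of_pinnedRegions_settingPrVolSharp
    (hpin : Cor312Vol.PinnedRegions
      (LatticeSituation.ofShells (logShellsDH X (analyticLogv F)) M archPk archSub
        (summandPiecesPr X (logvAnalytic_analyticLogv (F := F))).Adm
        (summandPiecesPr X (logvAnalytic_analyticLogv (F := F))).logvol Ψ act Mmod region frobAdm frobLogvol frobΨ frobMmod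
        unitImage ballImage thetaDiv)
      (settingPrVolSharp X (logvAnalytic_analyticLogv (F := F)) M archPk archSub Ψ act Mmod region n lat sig split qData tq t
        htq0 htq1) ρ qK)
    (q : ℕ) [hq : Fact q.Prime] (v₀ : HeightOneSpectrum (𝓞 F)) (hv : ((q : ℕ) : 𝓞 F) ∈ v₀.asIdeal) :
    ∀ g ∈ ismDH (analyticLogv F) (.inr v₀ : Thm311.Real.Place F),
      (fun a => toR q v₀ hv (g (ofR q v₀ hv a))) '' closedBall (0 : RescaledCompletion F q v₀ hv) 1 = closedBall 0 1 := by
  by_contra hne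
  push Not at hne
  exact not_pinnedRegions_settingPrVolSharp_of_mover_at X M archPk archSub Ψ act Mmod region frobAdm frobLogvol frobΨ frobMmod
    unitImage ballImage thetaDiv n lat sig split qData t tq ρ qK htq0 htq1 q v₀ hv hne hpin

/-- **(B1′) `PinnedRegions` at `settingPrVolSharp` ⇒ `𝒪_{v₀} = q^k·log_q(𝒪_{v₀}^×)` for some `k ∈ ℤ` at EVERY finite place `v₀ ∣ q`**
(abc-iut-w5-d180's BALL-MOVER CRITERION applied to (B1)). [cite: DupuyHilado2025, §4.9] [cite: WeilBNT1967, Ch. II §2, Th. 1–2] [claim: Mochizuki2012, status: disputed] -/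
theorem exists_closedBall_one_eq_zpow_smul_logUnits_of_pinnedRegions_settingPrVolSharp
    (hpin : Cor312Vol.PinnedRegions
      (LatticeSituation.ofShells (logShellsDH X (analyticLogv F)) M archPk archSub
        (summandPiecesPr X (logvAnalytic_analyticLogv (F := F))).Adm
        (summandPiecesPr X (logvAnalytic_analyticLogv (F := F))).logvol Ψ act Mmod region frobAdm frobLogvol frobΨ frobMmod
        unitImage ballImage thetaDiv)
      (settingPrVolSharp X (logvAnalytic_analyticLogv (F := F)) M archPk archSub Ψ act Mmod region n lat sig split qData tq t
        htq0 htq1) ρ qK)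
    (q : ℕ) [hq : Fact q.Prime] (v₀ : HeightOneSpectrum (𝓞 F)) (hv : ((q : ℕ) : 𝓞 F) ∈ v₀.asIdeal) :
    ∃ k : ℤ, closedBall (0 : RescaledCompletion F q v₀ hv) 1 =
      ((q : ℚ_[q]) ^ k) • (logUnits (RescaledCompletion F q v₀ hv) : Set (RescaledCompletion F q v₀ hv)) := by
  have h1 : (1 : RescaledCompletion F q v₀ hv) ≠ 0 := one_ne_zero
  have h := (forall_ismDH_image_closedBall_eq_iff (logvAnalyticAt_analyticLogv (F := F) q) v₀ hv h1).1
    (by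
      rw [norm_one]
      exact forall_ismDH_image_closedBall_one_eq_of_pinnedRegions_settingPrVolSharp X M archPk archSub Ψ act Mmod region frobAdm
        frobLogvol frobΨ frobMmod unitImage ballImage thetaDiv n lat sig split qData t tq ρ qK htq0 htq1 hpin q v₀ hv)
  rwa [norm_one] at h

/-- **(B2) THE FIXED-BALL SHAPE LIST IS EXHAUSTIVE, read from the pins: `PinnedRegions` at `settingPrVolSharp` ⇒ at EVERY finite place
`v₀ ∣ q`, `F_{v₀}` is unramified over an odd prime, or `ℚ_2`, or `ℚ_3(ζ_3)`-shaped, or `ℚ_2(√3)`-shaped (`log_2(𝒪^×) = 2𝒪`)** — §2 on (B1).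
[cite: DupuyHilado2025, §4.9] [cite: NeukirchANT1999, Ch. II Prop. (5.5), (5.7)] [claim: Mochizuki2012, status: disputed] -/
theorem localShape_of_pinnedRegions_settingPrVolSharp
    (hpin : Cor312Vol.PinnedRegions
      (LatticeSituation.ofShells (logShellsDH X (analyticLogv F)) M archPk archSub
        (summandPiecesPr X (logvAnalytic_analyticLogv (F := F))).Adm
        (summandPiecesPr X (logvAnalytic_analyticLogv (F := F))).logvol Ψ act Mmod region frobAdm frobLogvol frobΨ frobMmod
        unitImage ballImage thetaDiv)
      (settingPrVolSharp X (logvAnalytic_analyticLogv (F := F)) M archPk archSub Ψ act Mmod region n lat sig split qData tq t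
        htq0 htq1) ρ qK)
    (q : ℕ) [hq : Fact q.Prime] (v₀ : HeightOneSpectrum (𝓞 F)) (hv : ((q : ℕ) : 𝓞 F) ∈ v₀.asIdeal) :
    (v₀.asIdeal.ramificationIdx ℤ = 1 ∧ (q = 2 → v₀.asIdeal.inertiaDeg ℤ = 1)) ∨
    (q = 3 ∧ v₀.asIdeal.ramificationIdx ℤ = 2 ∧ v₀.asIdeal.inertiaDeg ℤ = 1 ∧ torsionPExp q (RescaledCompletion F q v₀ hv) = 1) ∨
    (q = 2 ∧ v₀.asIdeal.ramificationIdx ℤ = 2 ∧ v₀.asIdeal.inertiaDeg ℤ = 1 ∧ torsionPExp q (RescaledCompletion F q v₀ hv) = 1 ∧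
      logUnits (RescaledCompletion F q v₀ hv) =
        closedBall (0 : RescaledCompletion F q v₀ hv) ‖(2 : RescaledCompletion F q v₀ hv)‖) :=
  localShape_of_forall_ismDH_image_closedBall_one_eq (logvAnalyticAt_analyticLogv (F := F) q) v₀ hv
    (forall_ismDH_image_closedBall_one_eq_of_pinnedRegions_settingPrVolSharp X M archPk archSub Ψ act Mmod region frobAdm
      frobLogvol frobΨ frobMmod unitImage ballImage thetaDiv n lat sig split qData t tq ρ qK htq0 htq1 hpin q v₀ hv)

/-! ## 4. The Hermite–Minkowski cut -/

/-- **(B3) HERMITE–MINKOWSKI: `PinnedRegions` at `settingPrVolSharp` over a number field `F ≠ ℚ` (`1 < [F : ℚ]`) forces a RAMIFIED place,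
and that place is `ℚ_3(ζ_3)`-shaped (over `3`) or `ℚ_2(√3)`-shaped (over `2`).**  Mathlib's `NumberField.abs_discr_gt_two` (`|d_F| > 2`)
gives a prime `q ∣ d_F`; the tree's `Cor22.exists_ramified_place_of_dvd_discr` (Dedekind: `q ∣ d_F` ⇒ a place over `q` with `e ≥ 2`);
then (B2) at that place. [cite: NeukirchANT1999, Ch. III Thm. (2.12), (2.17)] [cite: DupuyHilado2025, §4.9] [claim: Mochizuki2012, status: disputed] -/
theorem exists_ramified_place_of_pinnedRegions_settingPrVolSharp
    (hpin : Cor312Vol.PinnedRegions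
      (LatticeSituation.ofShells (logShellsDH X (analyticLogv F)) M archPk archSub
        (summandPiecesPr X (logvAnalytic_analyticLogv (F := F))).Adm
        (summandPiecesPr X (logvAnalytic_analyticLogv (F := F))).logvol Ψ act Mmod region frobAdm frobLogvol frobΨ frobMmod
        unitImage ballImage thetaDiv)
      (settingPrVolSharp X (logvAnalytic_analyticLogv (F := F)) M archPk archSub Ψ act Mmod region n lat sig split qData tq t
        htq0 htq1) ρ qK)
    (hF : 1 < Module.finrank ℚ F) :
    (∃ (v₀ : HeightOneSpectrum (𝓞 F)) (hv : ((3 : ℕ) : 𝓞 F) ∈ v₀.asIdeal),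
        v₀.asIdeal.ramificationIdx ℤ = 2 ∧ v₀.asIdeal.inertiaDeg ℤ = 1 ∧ torsionPExp 3 (RescaledCompletion F 3 v₀ hv) = 1) ∨
    (∃ (v₀ : HeightOneSpectrum (𝓞 F)) (hv : ((2 : ℕ) : 𝓞 F) ∈ v₀.asIdeal),
        v₀.asIdeal.ramificationIdx ℤ = 2 ∧ v₀.asIdeal.inertiaDeg ℤ = 1 ∧ torsionPExp 2 (RescaledCompletion F 2 v₀ hv) = 1 ∧
          logUnits (RescaledCompletion F 2 v₀ hv) =
            closedBall (0 : RescaledCompletion F 2 v₀ hv) ‖(2 : RescaledCompletion F 2 v₀ hv)‖) := by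
  -- Hermite–Minkowski: a prime divides `d_F`
  have hne1 : (NumberField.discr F).natAbs ≠ 1 := by
    have h := NumberField.abs_discr_gt_two hF
    rw [Int.abs_eq_natAbs] at h
    omega
  obtain ⟨q, hq, hqd⟩ := Nat.exists_prime_and_dvd hne1
  have hqd' : (q : ℤ) ∣ NumberField.discr F := Int.natCast_dvd.mpr hqd
  -- Dedekind: a ramified place over `q`
  obtain ⟨v₀, hres, he2⟩ := Cor22.exists_ramified_place_of_dvd_discr F hq hqd'
  haveI : Fact q.Prime := ⟨hq⟩
  have hv₀ : (thetaIndex X).over (.inr v₀) = .inr ⟨q, hq⟩ := by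
    rw [over_inr_eq]; exact congrArg Sum.inr (Subtype.ext hres)
  have hv : ((q : ℕ) : 𝓞 F) ∈ v₀.asIdeal := natCast_mem_placeOf X (⟨q, hq⟩ : Nat.Primes) ⟨.inr v₀, hv₀⟩
  -- (B2) at the ramified place
  rcases localShape_of_forall_ismDH_image_closedBall_one_eq (logvAnalyticAt_analyticLogv (F := F) q) v₀ hv
      (forall_ismDH_image_closedBall_one_eq_of_pinnedRegions_settingPrVolSharp X M archPk archSub Ψ act Mmod region frobAdm
        frobLogvol frobΨ frobMmod unitImage ballImage thetaDiv n lat sig split qData t tq ρ qK htq0 htq1 hpin q v₀ hv) with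
    ⟨h1, -⟩ | ⟨hq3, h1, h2, h3⟩ | ⟨hq2, h1, h2, h3, h4⟩
  · omega
  · subst hq3
    exact Or.inl ⟨v₀, hv, h1, h2, h3⟩
  · subst hq2
    exact Or.inr ⟨v₀, hv, h1, h2, h3, h4⟩

/-- **(B3, class form) EVERY NUMBER FIELD `F ≠ ℚ` WITH `2 ∤ d_F`, `3 ∤ d_F`: `PinnedRegions` FAILS at `settingPrVolSharp`** (analytic
logarithms, every `X`, `ρ`, `qK`, column data, `Ψ`, ideles, column): a prime `q ∣ d_F` (Hermite–Minkowski) has `q ≥ 5`, and the ramified place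
over it feeds abc-iut-E-t44's `…_of_ramified_five_le_anyPrime`.  New class: fields WITHOUT a quadratic subfield (e.g. cubic fields with `(d_F, 6) = 1`).
[cite: NeukirchANT1999, Ch. III Thm. (2.12), (2.17)] [cite: DupuyHilado2025, §4.9] [claim: Mochizuki2012, status: disputed] -/
theorem not_pinnedRegions_settingPrVolSharp_of_not_dvd_discr (hF : 1 < Module.finrank ℚ F)
    (h2 : ¬ (2 : ℤ) ∣ NumberField.discr F) (h3 : ¬ (3 : ℤ) ∣ NumberField.discr F) :
    ¬ Cor312Vol.PinnedRegions
      (LatticeSituation.ofShells (logShellsDH X (analyticLogv F)) M archPk archSub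
        (summandPiecesPr X (logvAnalytic_analyticLogv (F := F))).Adm
        (summandPiecesPr X (logvAnalytic_analyticLogv (F := F))).logvol Ψ act Mmod region frobAdm frobLogvol frobΨ frobMmod
        unitImage ballImage thetaDiv)
      (settingPrVolSharp X (logvAnalytic_analyticLogv (F := F)) M archPk archSub Ψ act Mmod region n lat sig split qData tq t
        htq0 htq1) ρ qK := by
  have hne1 : (NumberField.discr F).natAbs ≠ 1 := by
    have h := NumberField.abs_discr_gt_two hF
    rw [Int.abs_eq_natAbs] at h
    omega
  obtain ⟨q, hq, hqd⟩ := Nat.exists_prime_and_dvd hne1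
  have hqd' : (q : ℤ) ∣ NumberField.discr F := Int.natCast_dvd.mpr hqd
  have hq2 : q ≠ 2 := by rintro rfl; exact h2 hqd'
  have hq3 : q ≠ 3 := by rintro rfl; exact h3 hqd'
  have hq4 : q ≠ 4 := fun h => by rw [h] at hq; exact absurd hq (by decide)
  have h5 : 5 ≤ q := by have := hq.two_le; omega
  obtain ⟨v₀, hres, he2⟩ := Cor22.exists_ramified_place_of_dvd_discr F hq hqd'
  haveI : Fact q.Prime := ⟨hq⟩
  have hv₀ : (thetaIndex X).over (.inr v₀) = .inr ⟨q, hq⟩ := by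
    rw [over_inr_eq]; exact congrArg Sum.inr (Subtype.ext hres)
  exact not_pinnedRegions_settingPrVolSharp_of_ramified_five_le_anyPrime X M archPk archSub Ψ act Mmod region frobAdm frobLogvol frobΨ
    frobMmod unitImage ballImage thetaDiv n lat sig split qData t tq ρ qK htq0 htq1 ⟨q, hq⟩ h5 v₀ hv₀ he2

/-- The same for `PinnedRegions3`. [claim: Mochizuki2012, status: disputed] -/
theorem not_pinnedRegions3_settingPrVolSharp_of_not_dvd_discr (hF : 1 < Module.finrank ℚ F)
    (h2 : ¬ (2 : ℤ) ∣ NumberField.discr F) (h3 : ¬ (3 : ℤ) ∣ NumberField.discr F) :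
    ¬ Cor312Vol.PinnedRegions3
      (LatticeSituation.ofShells (logShellsDH X (analyticLogv F)) M archPk archSub
        (summandPiecesPr X (logvAnalytic_analyticLogv (F := F))).Adm
        (summandPiecesPr X (logvAnalytic_analyticLogv (F := F))).logvol Ψ act Mmod region frobAdm frobLogvol frobΨ frobMmod
        unitImage ballImage thetaDiv)
      (settingPrVolSharp X (logvAnalytic_analyticLogv (F := F)) M archPk archSub Ψ act Mmod region n lat sig split qData tq t
        htq0 htq1) ρ qK :=
  fun h => not_pinnedRegions_settingPrVolSharp_of_not_dvd_discr X M archPk archSub Ψ act Mmod region frobAdm frobLogvol frobΨ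
    frobMmod unitImage ballImage thetaDiv n lat sig split qData t tq ρ qK htq0 htq1 hF h2 h3 h.1

/-- **(B3, ramification form) EVERY NUMBER FIELD `F ≠ ℚ` IN WHICH `2` AND `3` ARE UNRAMIFIED (`e = 1` at every place over `2` and over
`3`): `PinnedRegions` FAILS at `settingPrVolSharp`** — analytic logarithms, every `X`, `ρ`, `qK`, column data, `Ψ`, ideles, column.
[cite: NeukirchANT1999, Ch. III Thm. (2.12), (2.17)] [cite: DupuyHilado2025, §4.9] [claim: Mochizuki2012, status: disputed] -/
theorem not_pinnedRegions_settingPrVolSharp_of_unramified_two_three (hF : 1 < Module.finrank ℚ F)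
    (h2 : ∀ v : HeightOneSpectrum (𝓞 F), ((2 : ℕ) : 𝓞 F) ∈ v.asIdeal → v.asIdeal.ramificationIdx ℤ = 1)
    (h3 : ∀ v : HeightOneSpectrum (𝓞 F), ((3 : ℕ) : 𝓞 F) ∈ v.asIdeal → v.asIdeal.ramificationIdx ℤ = 1) :
    ¬ Cor312Vol.PinnedRegions
      (LatticeSituation.ofShells (logShellsDH X (analyticLogv F)) M archPk archSub
        (summandPiecesPr X (logvAnalytic_analyticLogv (F := F))).Adm
        (summandPiecesPr X (logvAnalytic_analyticLogv (F := F))).logvol Ψ act Mmod region frobAdm frobLogvol frobΨ frobMmod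
        unitImage ballImage thetaDiv)
      (settingPrVolSharp X (logvAnalytic_analyticLogv (F := F)) M archPk archSub Ψ act Mmod region n lat sig split qData tq t
        htq0 htq1) ρ qK := by
  intro hpin
  rcases exists_ramified_place_of_pinnedRegions_settingPrVolSharp X M archPk archSub Ψ act Mmod region frobAdm frobLogvol frobΨ
      frobMmod unitImage ballImage thetaDiv n lat sig split qData t tq ρ qK htq0 htq1 hpin hF with
    ⟨v₀, hv, he, -⟩ | ⟨v₀, hv, he, -⟩
  · have := h3 v₀ hv; omega
  · have := h2 v₀ hv; omega

/-- The same for `PinnedRegions3`. [claim: Mochizuki2012, status: disputed] -/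
theorem not_pinnedRegions3_settingPrVolSharp_of_unramified_two_three (hF : 1 < Module.finrank ℚ F)
    (h2 : ∀ v : HeightOneSpectrum (𝓞 F), ((2 : ℕ) : 𝓞 F) ∈ v.asIdeal → v.asIdeal.ramificationIdx ℤ = 1)
    (h3 : ∀ v : HeightOneSpectrum (𝓞 F), ((3 : ℕ) : 𝓞 F) ∈ v.asIdeal → v.asIdeal.ramificationIdx ℤ = 1) :
    ¬ Cor312Vol.PinnedRegions3
      (LatticeSituation.ofShells (logShellsDH X (analyticLogv F)) M archPk archSub
        (summandPiecesPr X (logvAnalytic_analyticLogv (F := F))).Adm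
        (summandPiecesPr X (logvAnalytic_analyticLogv (F := F))).logvol Ψ act Mmod region frobAdm frobLogvol frobΨ frobMmod
        unitImage ballImage thetaDiv)
      (settingPrVolSharp X (logvAnalytic_analyticLogv (F := F)) M archPk archSub Ψ act Mmod region n lat sig split qData tq t
        htq0 htq1) ρ qK :=
  fun h => not_pinnedRegions_settingPrVolSharp_of_unramified_two_three X M archPk archSub Ψ act Mmod region frobAdm frobLogvol frobΨ
    frobMmod unitImage ballImage thetaDiv n lat sig split qData t tq ρ qK htq0 htq1 hF h2 h3 h.1

end Summit.ABC.IUTFork.Joshi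

end
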